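import Summits.QuantumFields.YangMills.Theorems.FlatTubeReductionRateAlpha
import Summits.QuantumFields.YangMills.Theorems.LuscherReductionTwistedTraceScalingBTRatesBudget
import HarnessLib

/-!
# The TAIL BUDGET of the dressed (B-T) brick, eventually: the hypotheses (H1), (H1'), (H2), (H3), `(κ₂/12)ℓ(B) ≤ 1` of `…DressedTauBudget.dressedTau_le` along the rate schedule
# with the threshold `α_r = A·β^{-1/2}√log β`, `κ₂ = β^{-1}`, quaternion core `ρ = btEps/3`
# (route `FlatTubeReduction`, crux K1 `NearFlatRatioLaw` stmt-QuantumFields-24720; seat `ym-line-ftr-p1` g15; rate twin «ratepack-v3 / frozen fibres»; R2b1 RECORD rung — no summit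
# statement is proved here)

WHY (NOTES T6d; rate twin of lane A's `…BTRatesBudget.eventually_budget`, whose atoms `eventually_btM0_le`, `btMnt_ge_sq`, `btMfar_ge_min`, `budget_rhs_ge`, `budget_rhs_ge'`,
`eventually_budget_elementary` are reused).  Differences from lane A: the window is `δ = D·recordDelta1 L (1/6)` (`D ≥ 1`); the near tail carries the off-diagonal factor
`e^{3Bα_r²} = β^{3|Site|A²}` (polynomial GROWTH, beaten by `e^{−βm_nt} ≤ e^{−log²β}`) and the magnetic factor `e^{β·step(x,σ)} ≤ e`; the far signal branch of `m_far` is only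
`(|Site|A²/48)·log β` (polynomial decay `β^{−|Site|A²/48}`, enough once `|Site|A² ≥ 48(3|Site|+7)`, e.g. `A = 16` for `L ≥ 2`); the cross term needs the SQUARED budget (H1').
* `eventually_exp_lin_logsq_le` (`exp(K + p·log β − q·log²β) ≤ C(β^{-1})^m`), `eventually_exp_sub_mul_log_le` (`exp(K − p·log β) ≤ C(β^{-1})^m`, `p > m`);
* `eventually_beta_step_le_one_D`, ★ `eventually_btMnt_ge_rate`, ★ `eventually_exp_neg_btMfar_le_rate`;
* ★★ `eventually_dressed_budget` — all eight conjuncts, eventually.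
HONEST FRAMING: real-analysis bookkeeping for a stub of the CONDITIONAL reduction route R2b1; femto rung R2b1 (RECORD label); not infinite volume, not a gap, not Clay.  No defs, no named
facts, no `sorry`.
-/

set_option autoImplicit false

noncomputable section

open MeasureTheory Filter Topology Real Asymptotics
open scoped BigOperators
open Literature.MathematicalPhysics.QuantumFieldTheory
open Literature.MathematicalPhysics.QuantumLattice

namespace Summit.QuantumFields.YangMills.Theorems.FemtoTransferGap.TwoLattice.ConstTube

open Summit.QuantumFields.YangMills.Theorems.FemtoTransferGap
open Summit.QuantumFields.YangMills.Theorems.FemtoTransferGap.TwoLattice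
open Summit.QuantumFields.YangMills.Theorems.FemtoTransferGap.TwoLattice.Avg
open Summit.QuantumFields.YangMills.Theorems.FemtoTransferGap.TwoLattice.Cov

variable {L : ℕ} [NeZero L]

/-! ## §1 Two exponential comparisons -/

omit [NeZero L] in
/-- `exp(K + p·log β − q·log²β) ≤ C·(β^{-1})^m` eventually, for `q, C > 0`. [folklore] -/
theorem eventually_exp_lin_logsq_le {K p q C : ℝ} (hq : 0 < q) (hC : 0 < C) (m : ℕ) :
    ∀ᶠ β : ℝ in atTop, Real.exp (K + p * Real.log β - q * Real.log β ^ 2) ≤ C * powScale 1 β ^ m := by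
  filter_upwards [eventually_ge_atTop (1 : ℝ), eventually_ge_atTop (Real.exp (max 1 ((m + |K| + |Real.log C| + |p|) / q)))] with β hβ1 hβT
  have hβ0 : 0 < β := by linarith
  have htT : max 1 ((m + |K| + |Real.log C| + |p|) / q) ≤ Real.log β := by
    rw [← Real.log_exp (max 1 _)]; exact Real.log_le_log (Real.exp_pos _) hβT
  set t := Real.log β with ht
  have ht1 : 1 ≤ t := le_trans (le_max_left _ _) htT
  have hqt : (m : ℝ) + |K| + |Real.log C| + |p| ≤ q * t := by
    have := le_trans (le_max_right _ _) htT
    rw [div_le_iff₀ hq] at this; linarith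
  have hy : powScale 1 β = Real.exp (-t) := by
    rw [powScale_eq hβ1, Real.rpow_neg_one, ht, Real.exp_neg, Real.exp_log hβ0]
  have hCe : C = Real.exp (Real.log C) := (Real.exp_log hC).symm
  rw [hy, ← Real.exp_nat_mul, hCe, ← Real.exp_add, Real.exp_le_exp]
  have h1 : ((m : ℝ) + |K| + |Real.log C| + |p|) * t ≤ q * t * t := mul_le_mul_of_nonneg_right hqt (by linarith)
  have h2 : |K| + |Real.log C| ≤ (|K| + |Real.log C|) * t := le_mul_of_one_le_right (by positivity) ht1
  have hK := le_abs_self K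
  have hC' := neg_abs_le (Real.log C)
  have hp : p * t ≤ |p| * t := mul_le_mul_of_nonneg_right (le_abs_self p) (by linarith)
  have hsq : q * t ^ 2 = q * t * t := by ring
  rw [hsq]; nlinarith

omit [NeZero L] in
/-- `exp(K − p·log β) ≤ C·(β^{-1})^m` eventually, for `p > m`, `C > 0`. [folklore] -/
theorem eventually_exp_sub_mul_log_le {K p C : ℝ} (m : ℕ) (hp : (m : ℝ) < p) (hC : 0 < C) :
    ∀ᶠ β : ℝ in atTop, Real.exp (K - p * Real.log β) ≤ C * powScale 1 β ^ m := by
  filter_upwards [eventually_ge_atTop (1 : ℝ), eventually_ge_atTop (Real.exp ((|K| + |Real.log C|) / (p - m)))] with β hβ1 hβT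
  have hβ0 : 0 < β := by linarith
  have hpm : 0 < p - m := by linarith
  have htT : (|K| + |Real.log C|) / (p - m) ≤ Real.log β := by
    rw [← Real.log_exp ((|K| + |Real.log C|) / (p - m))]; exact Real.log_le_log (Real.exp_pos _) hβT
  set t := Real.log β with ht
  have hqt : |K| + |Real.log C| ≤ (p - m) * t := by rw [div_le_iff₀ hpm] at htT; linarith
  have hy : powScale 1 β = Real.exp (-t) := by
    rw [powScale_eq hβ1, Real.rpow_neg_one, ht, Real.exp_neg, Real.exp_log hβ0]
  have hCe : C = Real.exp (Real.log C) := (Real.exp_log hC).symm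
  rw [hy, ← Real.exp_nat_mul, hCe, ← Real.exp_add, Real.exp_le_exp]
  have hK := le_abs_self K
  have hC' := neg_abs_le (Real.log C)
  nlinarith

/-! ## §2 The magnetic factor and the two defect masses at the rate window -/

/-- ★ `β·stepActionErr(β^{-1/2}, 12L³δ⁴) ≤ 1` eventually at the rate window (`= N_pl(1728√σ + 29376x + 700569x²)`, `√σ ≤ 4L²δ²`). [folklore] -/
theorem eventually_beta_step_le_one_D {D : ℝ} (hD : 1 ≤ D) :
    ∀ᶠ β : ℝ in atTop, β * stepActionErr (L := L) (powScale (1 / 2) β) ((L : ℝ) ^ 3 * (12 * (D * recordDelta1 L (1 / 6) β) ^ 4)) ≤ 1 := by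
  apply eventually_le_one_of_le_C1C2 (L := L) (C₁ := (Fintype.card (Plaquette 3 L) : ℝ) * (1728 * (4 * (L : ℝ) ^ 2)))
    (C₂ := (Fintype.card (Plaquette 3 L) : ℝ) * (29376 + 700569)) D
  filter_upwards [eventually_rate_schedule_facts₂ (L := L) hD] with β h
  obtain ⟨hβ1, -, hℓ1, -, -, -, -, hx0, hx1, -, -, -, -, -, -, -, -, -, hsσ, -, -, -⟩ := h
  have hNpl : (0 : ℝ) ≤ (Fintype.card (Plaquette 3 L) : ℝ) := Nat.cast_nonneg _
  have hβx : β * powScale (1 / 2) β ^ 2 = 1 := mul_powScale_half_sq hβ1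
  set x := powScale (1 / 2) β
  set δ := D * recordDelta1 L (1 / 6) β
  set ℓ := btLog β
  unfold stepActionErr
  have e : β * ((Fintype.card (Plaquette 3 L) : ℝ) * (1728 * x ^ 2 * Real.sqrt ((L : ℝ) ^ 3 * (12 * δ ^ 4)) + 29376 * x ^ 3 + 700569 * x ^ 4)) =
      (Fintype.card (Plaquette 3 L) : ℝ) * (1728 * Real.sqrt ((L : ℝ) ^ 3 * (12 * δ ^ 4)) + 29376 * x + 700569 * x ^ 2) * (β * x ^ 2) := by ring
  rw [e, hβx, mul_one]
  have hx2 : x ^ 2 ≤ x := by nlinarith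
  have hx3 : x ≤ x * ℓ ^ 3 := le_mul_of_one_le_right hx0 (one_le_pow₀ hℓ1)
  have h1 : 1728 * Real.sqrt ((L : ℝ) ^ 3 * (12 * δ ^ 4)) + 29376 * x + 700569 * x ^ 2 ≤ 1728 * (4 * (L : ℝ) ^ 2) * δ ^ 2 + (29376 + 700569) * (x * ℓ ^ 3) := by
    nlinarith
  calc (Fintype.card (Plaquette 3 L) : ℝ) * (1728 * Real.sqrt ((L : ℝ) ^ 3 * (12 * δ ^ 4)) + 29376 * x + 700569 * x ^ 2)
      ≤ (Fintype.card (Plaquette 3 L) : ℝ) * (1728 * (4 * (L : ℝ) ^ 2) * δ ^ 2 + (29376 + 700569) * (x * ℓ ^ 3)) := mul_le_mul_of_nonneg_left h1 hNpl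
    _ = _ := by ring

/-- ★ Eventually `log²β ≤ β·m_nt` at the rate window for any threshold family `α ≤ btAlpha` (both branches of `m_nt` exceed `xℓ`; `βx²ℓ² = ℓ²`). [folklore] -/
theorem eventually_btMnt_ge_rate {D : ℝ} (hD : 1 ≤ D) {α : ℝ → ℝ} (hαU : ∀ᶠ β : ℝ in atTop, α β ≤ btAlpha β) :
    ∀ᶠ β : ℝ in atTop, Real.log β ^ 2 ≤ β * btMnt L (D * recordDelta1 L (1 / 6) β) (α β) (btRad β) (btR1 β) (btEps β) := by
  have hL1 : (1 : ℝ) ≤ L := by exact_mod_cast NeZero.one_le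
  have hL0 : (0 : ℝ) < L := by linarith
  filter_upwards [eventually_rate_schedule_facts (L := L) hD, eventually_ge_atTop (Real.exp 14), hαU] with β hf hβ14 hU
  obtain ⟨hβ1, hℓeq, -, hreq, hεx, hxδ, hxℓ, -, hδs, -, hδhalf⟩ := hf
  have hℓ14 : 14 ≤ Real.log β := by rw [← Real.log_exp 14]; exact Real.log_le_log (Real.exp_pos _) hβ14
  set x := powScale (1 / 2) β with hxdef
  set δ := D * recordDelta1 L (1 / 6) β with hδdef
  set ℓ := Real.log β with hℓdef
  have hx0 : 0 < x := powScale_pos _ _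
  have hδ0 : 0 ≤ δ := scaledDelta1_nonneg (by linarith) β
  have hε0 : 0 ≤ btEps β := (btEps_pos_le β).1.le
  have hβx : β * x ^ 2 = 1 := mul_powScale_half_sq hβ1
  have hαeq : btAlpha β = x * ℓ := by unfold btAlpha; rw [hℓeq]
  have hR₁eq : btR1 β = 5 * x * ℓ := by unfold btR1; rw [hℓeq]
  have h2 : Real.sqrt 2 ≤ 3 / 2 := by rw [Real.sqrt_le_left (by norm_num)]; norm_num
  have hs20 : 0 ≤ Real.sqrt 2 := Real.sqrt_nonneg _
  have hxℓ0 : 0 ≤ x * ℓ := by positivity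
  have hαx : α β ≤ x * ℓ := by rw [← hαeq]; exact hU
  have hkey : (x * ℓ) ^ 2 ≤ btMnt L δ (α β) (btRad β) (btR1 β) (btEps β) := by
    refine btMnt_ge_sq (L := L) hxℓ0 ?_ ?_
    · rw [hreq, hR₁eq]
      have e2x : Real.sqrt 2 * x ≤ 3 / 2 * x := mul_le_mul_of_nonneg_right h2 hx0.le
      have hx2 : x ^ 2 ≤ x := by nlinarith
      have e1 : 2 * (Real.sqrt 2 * x + δ) * btEps β ≤ 4 * x := by
        have h3 : Real.sqrt 2 * x + δ ≤ 3 / 2 * x + 1 / 2 := by linarith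
        have h4 : 2 * (Real.sqrt 2 * x + δ) * btEps β ≤ 2 * (3 / 2 * x + 1 / 2) * x :=
          mul_le_mul (by linarith) hεx hε0 (by positivity)
        have h5 : 2 * (3 / 2 * x + 1 / 2) * x = 3 * x ^ 2 + x := by ring
        linarith
      have e3 : x * 14 ≤ x * ℓ := mul_le_mul_of_nonneg_left hℓ14 hx0.le
      linarith
    · rw [hreq]
      have e2x : Real.sqrt 2 * x ≤ 3 / 2 * x := mul_le_mul_of_nonneg_right h2 hx0.le
      have hu60 : (1 : ℝ) / (60 * L) = 1 / (3 * L) / 20 := by ring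
      have hu4000 : (1 : ℝ) / (4000 * L) = 1 / (3 * L) * (3 / 4000) := by ring
      have hu0 : (0 : ℝ) < 1 / (3 * L) := by positivity
      rw [hu60] at hxℓ
      rw [hu4000] at hδs
      have hx9 : 9 * x ≤ δ := by linarith
      linarith
  calc ℓ ^ 2 = β * (x * ℓ) ^ 2 := by rw [mul_pow, ← mul_assoc, hβx, one_mul]
    _ ≤ β * btMnt L δ (α β) (btRad β) (btR1 β) (btEps β) := mul_le_mul_of_nonneg_left hkey (by linarith)

/-- `c·powScale(1/2) ≤ α_r` eventually (`A ≥ 1`, `√ℓ ≥ c` once `log β ≥ c²`). [folklore] -/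
theorem eventually_const_powScale_le_alphaR {A : ℝ} (hA : 1 ≤ A) (c : ℝ) :
    ∀ᶠ β : ℝ in atTop, c * powScale (1 / 2) β ≤ A * powScale (1 / 2) β * Real.sqrt (btLog β) := by
  filter_upwards [Real.tendsto_log_atTop.eventually_ge_atTop (c ^ 2)] with β hc2
  have hℓc : c ^ 2 ≤ btLog β := hc2.trans (le_max_left _ _)
  have hsc : c ≤ Real.sqrt (btLog β) := by
    calc c ≤ |c| := le_abs_self c
      _ = Real.sqrt (c ^ 2) := (Real.sqrt_sq_eq_abs c).symm
      _ ≤ Real.sqrt (btLog β) := Real.sqrt_le_sqrt hℓc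
  have hx0 : 0 ≤ powScale (1 / 2) β := (powScale_pos _ _).le
  have hs0 : 0 ≤ Real.sqrt (btLog β) := Real.sqrt_nonneg _
  calc c * powScale (1 / 2) β ≤ Real.sqrt (btLog β) * powScale (1 / 2) β := mul_le_mul_of_nonneg_right hsc hx0
    _ ≤ (A * Real.sqrt (btLog β)) * powScale (1 / 2) β := mul_le_mul_of_nonneg_right (le_mul_of_one_le_left hs0 hA) hx0
    _ = A * powScale (1 / 2) β * Real.sqrt (btLog β) := by ring

/-- `e^{−min(a,b)} ≤ e^{−a} + e^{−b}`. [folklore] -/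
theorem exp_neg_min_le (a b : ℝ) : Real.exp (-min a b) ≤ Real.exp (-a) + Real.exp (-b) := by
  rcases le_total a b with h | h
  · rw [min_eq_left h]; linarith [Real.exp_pos (-b)]
  · rw [min_eq_right h]; linarith [Real.exp_pos (-a)]

/-- ★ Eventually `e^{−β·m_far} ≤ e^{−q₁log²β} + e^{−p·log β}` at the rate window with the threshold `α_r` (`q₁ = 7056D²/|Site|²` from the rough branch `(6δ)²`,
`p = |Site|A²/48` from the signal branch `(|Site|α_r/4)²/|E|`). [folklore] -/
theorem eventually_exp_neg_btMfar_le_rate {D A : ℝ} (hD : 1 ≤ D) (hA : 1 ≤ A) :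
    ∀ᶠ β : ℝ in atTop,
      Real.exp (-(β * btMfar L (D * recordDelta1 L (1 / 6) β) (A * powScale (1 / 2) β * Real.sqrt (btLog β)) (btRad β) (btEps β) (13 * (D * recordDelta1 L (1 / 6) β)))) ≤
        Real.exp (-(7056 * D ^ 2 / (Fintype.card (Site 3 L) : ℝ) ^ 2 * Real.log β ^ 2)) +
          Real.exp (-((Fintype.card (Site 3 L) : ℝ) * A ^ 2 / 48 * Real.log β)) := by
  have hL1 : (1 : ℝ) ≤ L := by exact_mod_cast NeZero.one_le
  have hL0 : (0 : ℝ) < L := by linarith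
  have hN : (0 : ℝ) < Fintype.card (Site 3 L) := by exact_mod_cast Fintype.card_pos
  have hN1 : (1 : ℝ) ≤ Fintype.card (Site 3 L) := by exact_mod_cast Fintype.card_pos
  have hE : (0 : ℝ) < Fintype.card (Edge 3 L) := by exact_mod_cast Fintype.card_pos
  have hA0 : 0 ≤ A := by linarith
  filter_upwards [eventually_rate_schedule_facts (L := L) hD, eventually_const_powScale_le_alphaR hA 9, eventually_alphaR_le_btAlpha A,
    eventually_logsq_le_mul_powScale (show (1 / 6 : ℝ) < 1 / 2 by norm_num)] with β hf h9 hU hlog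
  obtain ⟨hβ1, hℓeq, hℓ6, hreq, hεx, hxδ, hxℓ1, -, hδs, hεs, hδhalf⟩ := hf
  set x := powScale (1 / 2) β with hxdef
  set δ := D * recordDelta1 L (1 / 6) β with hδdef
  set ℓ := Real.log β with hℓdef
  set N := (Fintype.card (Site 3 L) : ℝ) with hNdef
  set αr := A * powScale (1 / 2) β * Real.sqrt (btLog β) with hαr
  have hβ0 : 0 < β := by linarith
  have hx0 : 0 < x := powScale_pos _ _
  have hδ0 : 0 ≤ δ := scaledDelta1_nonneg (by linarith) β
  have hε0 : 0 ≤ btEps β := (btEps_pos_le β).1.le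
  have hβx : β * x ^ 2 = 1 := mul_powScale_half_sq hβ1
  have hαr0 : 0 ≤ αr := alphaR_nonneg hA0 β
  have hαx : αr ≤ x * ℓ := by rw [← hℓeq]; exact hU
  have h2 : Real.sqrt 2 ≤ 3 / 2 := by rw [Real.sqrt_le_left (by norm_num)]; norm_num
  have hs20 : 0 ≤ Real.sqrt 2 := Real.sqrt_nonneg _
  have hLδ : (L : ℝ) * δ < 1 / 4000 := by
    have := mul_lt_mul_of_pos_left hδs hL0; rwa [show (L : ℝ) * (1 / (4000 * L)) = 1 / 4000 by field_simp] at this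
  -- the two branches
  have hm₁ : 6 * δ ≤ 13 * δ - 4 * (Real.sqrt 2 * btRad β + δ) - (2 * Real.sqrt 2 * btRad β + 2 * δ) := by
    rw [hreq]
    have e2 : 6 * Real.sqrt 2 * x ≤ 9 * x := by nlinarith
    have hx9 : 9 * x ≤ δ := by linarith
    linarith
  have hm₂ : N * αr / 4 ≤ N * (1 - 3 * L * (13 * δ)) * αr -
      (2 * btEps β * N * δ + 2 * btRad β ^ 2 + 2 * Real.sqrt 2 * N * (9 * L * (13 * δ) + btEps β) * btRad β) := by
    rw [hreq]
    have hNx : 0 ≤ N * x := by positivity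
    have h39 : 1 / 2 ≤ 1 - 3 * (L : ℝ) * (13 * δ) := by linarith
    have hsig : N * (1 / 2) * αr ≤ N * (1 - 3 * L * (13 * δ)) * αr := by gcongr
    have j1 : 2 * btEps β * N * δ ≤ N * x := by
      have h := mul_le_mul hεx hδhalf hδ0 hx0.le
      have := mul_le_mul_of_nonneg_left h (by positivity : (0 : ℝ) ≤ 2 * N)
      have e : 2 * N * (btEps β * δ) = 2 * btEps β * N * δ := by ring
      have e' : 2 * N * (x * (1 / 2)) = N * x := by ring
      linarith
    have j2 : 2 * x ^ 2 ≤ N * x := by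
      have hx56 : x ≤ 1 / 2 := by linarith
      have h := mul_le_mul_of_nonneg_left hx56 hx0.le
      have h' : x ≤ N * x := le_mul_of_one_le_left hx0.le hN1
      nlinarith
    have j3 : 2 * Real.sqrt 2 * N * (9 * L * (13 * δ) + btEps β) * x ≤ 3 * (31 / 1000) * (N * x) := by
      have hin : 9 * (L : ℝ) * (13 * δ) + btEps β ≤ 31 / 1000 := by linarith
      have hin0 : 0 ≤ 9 * (L : ℝ) * (13 * δ) + btEps β := by positivity
      have h22 : 2 * Real.sqrt 2 ≤ 3 := by linarith
      calc 2 * Real.sqrt 2 * N * (9 * L * (13 * δ) + btEps β) * x = 2 * Real.sqrt 2 * (9 * L * (13 * δ) + btEps β) * (N * x) := by ring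
        _ ≤ 3 * (31 / 1000) * (N * x) := mul_le_mul_of_nonneg_right (mul_le_mul h22 hin hin0 (by norm_num)) hNx
    have hαN : N * (9 * x) ≤ N * αr := mul_le_mul_of_nonneg_left h9 hN.le
    linarith
  have hfloor := btMfar_ge_min (L := L) (by positivity : (0 : ℝ) ≤ 6 * δ) (by positivity : 0 ≤ N * αr / 4) hm₁ hm₂
  -- `β·(6δ)² ≥ q₁ℓ²` and `β(Nα_r/4)²/|E| = (NA²/48)·btLog β ≥ p·ℓ`
  have hq1 : 7056 * D ^ 2 / N ^ 2 * ℓ ^ 2 ≤ β * (6 * δ) ^ 2 := by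
    have hδeq : δ = D * (14 * powScale (1 / 6) β / N) := rfl
    have hp2 : powScale (1 / 6) β ^ 2 = powScale (2 * (1 / 6)) β := by
      rw [powScale_eq hβ1, powScale_eq hβ1, ← Real.rpow_mul_natCast hβ0.le]; norm_num
    have e : β * (6 * δ) ^ 2 = 7056 * D ^ 2 / N ^ 2 * (β * powScale (2 * (1 / 6)) β) := by rw [hδeq, ← hp2]; field_simp; ring
    rw [e]
    exact mul_le_mul_of_nonneg_left hlog (by positivity)
  have hE3 : (Fintype.card (Edge 3 L) : ℝ) = 3 * N := by rw [card_edge_three L, hNdef, card_site_cube]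
  have hq2 : N * A ^ 2 / 48 * ℓ ≤ β * ((N * αr / 4) ^ 2 / Fintype.card (Edge 3 L)) := by
    have hℓ0 : 0 ≤ btLog β := le_trans zero_le_one (one_le_btLog β)
    have hαsq : αr ^ 2 = A ^ 2 * x ^ 2 * btLog β := by rw [hαr, mul_pow, mul_pow, Real.sq_sqrt hℓ0]
    have e : β * ((N * αr / 4) ^ 2 / Fintype.card (Edge 3 L)) = N * A ^ 2 / 48 * btLog β * (β * x ^ 2) := by
      rw [hE3, show (N * αr / 4) ^ 2 = N ^ 2 * αr ^ 2 / 16 by ring, hαsq]; field_simp; ring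
    rw [e, hβx, mul_one, hℓeq]
  have hmin : min (7056 * D ^ 2 / N ^ 2 * ℓ ^ 2) (N * A ^ 2 / 48 * ℓ) ≤
      β * btMfar L δ αr (btRad β) (btEps β) (13 * δ) := by
    calc min (7056 * D ^ 2 / N ^ 2 * ℓ ^ 2) (N * A ^ 2 / 48 * ℓ) ≤ min (β * (6 * δ) ^ 2) (β * ((N * αr / 4) ^ 2 / Fintype.card (Edge 3 L))) := min_le_min hq1 hq2
      _ = β * min ((6 * δ) ^ 2) ((N * αr / 4) ^ 2 / Fintype.card (Edge 3 L)) := (mul_min_of_nonneg _ _ hβ0.le).symm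
      _ ≤ _ := mul_le_mul_of_nonneg_left hfloor hβ0.le
  calc Real.exp (-(β * btMfar L δ αr (btRad β) (btEps β) (13 * δ))) ≤ Real.exp (-min (7056 * D ^ 2 / N ^ 2 * ℓ ^ 2) (N * A ^ 2 / 48 * ℓ)) :=
        Real.exp_le_exp.mpr (by linarith)
    _ ≤ _ := exp_neg_min_le _ _

/-! ## §3 ★★ The budget of the dressed brick, eventually -/

set_option maxHeartbeats 1600000 in
/-- ★★ **ALL hypotheses of `…DressedTauBudget.dressedTau_le` eventually** along the rate schedule: `B ≥ 1`, `B ≥ 2/r⋆³`, `2ρ < R₁` (`ρ = btEps/3`), `(κ₂/12)ℓ(B) ≤ 1`, (H1), (H1'),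
(H2), (H3) — with `κ₂ = β^{-1}`, `t = R = btRad`, `δ = D·recordDelta1 L (1/6)`, `α = α_r = A·β^{-1/2}√btLog β`, `ε = btEps`, `R₁ = btR1`, `P₀ = 13δ`, provided
`|Site|·A² ≥ 48(3|Site| + 7)` (e.g. `A = 16` for `L ≥ 2`). [folklore] -/
theorem eventually_dressed_budget {D A : ℝ} (hD : 1 ≤ D) (hA : 1 ≤ A) (hAN : 48 * (3 * (Fintype.card (Site 3 L) : ℝ) + 7) ≤ (Fintype.card (Site 3 L) : ℝ) * A ^ 2) :
    ∀ᶠ β : ℝ in atTop, 1 ≤ (L : ℝ) ^ 3 * β ∧ 2 / rStar ^ 3 ≤ (L : ℝ) ^ 3 * β ∧ 2 * (btEps β / 3) < btR1 β ∧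
      ((powScale 1 β) / 12 * (Real.exp (-3) * ((L : ℝ) ^ 3 * β) ^ (-(9 : ℝ) / 2) / 2000) ≤ 1) ∧
      (Real.exp (β * ((Fintype.card (Edge 3 L) : ℝ) * (2 * (btEps β / 3) + 2 * Real.sqrt 2 * (btRad β)) ^ 2) + β * ((10 * Real.sqrt (Fintype.card (Plaquette 3 L × Fin 3)) * (btRad β)) ^ 2 +
        stepActionErr (L := L) (btRad β) 0)) * (Real.exp (3 * ((L : ℝ) ^ 3 * β) * (A * powScale (1 / 2) β * Real.sqrt (btLog β)) ^ 2) *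
          Real.exp (-(β * btMnt L (D * recordDelta1 L (1 / 6) β) (A * powScale (1 / 2) β * Real.sqrt (btLog β)) (btRad β) (btR1 β) (btEps β)) + β * stepActionErr (L := L) (btRad β) ((L : ℝ) ^ 3 * (12 * (D * recordDelta1 L (1 / 6) β) ^ 4)))) ≤
        (powScale 1 β) / 12 * (gaugeMeasure L).real (gaugeCore L (btEps β / 3)) * (Real.exp (-3) * ((L : ℝ) ^ 3 * β) ^ (-(9 : ℝ) / 2) / 2000)) ∧
      (Real.exp (β * ((Fintype.card (Edge 3 L) : ℝ) * (2 * (btEps β / 3) + 2 * Real.sqrt 2 * (btRad β)) ^ 2) + β * ((10 * Real.sqrt (Fintype.card (Plaquette 3 L × Fin 3)) * (btRad β)) ^ 2 +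
        stepActionErr (L := L) (btRad β) 0)) * Real.exp (-(β * btMnt L (D * recordDelta1 L (1 / 6) β) (A * powScale (1 / 2) β * Real.sqrt (btLog β)) (btRad β) (btR1 β) (btEps β)) + β * stepActionErr (L := L) (btRad β) ((L : ℝ) ^ 3 * (12 * (D * recordDelta1 L (1 / 6) β) ^ 4))) ≤
        (gaugeMeasure L).real (gaugeCore L (btEps β / 3)) * ((powScale 1 β) / 12 * (Real.exp (-3) * ((L : ℝ) ^ 3 * β) ^ (-(9 : ℝ) / 2) / 2000)) ^ 2) ∧
      (Real.exp (β * ((Fintype.card (Edge 3 L) : ℝ) * (2 * (btEps β / 3) + 2 * Real.sqrt 2 * (btRad β)) ^ 2) + β * ((10 * Real.sqrt (Fintype.card (Plaquette 3 L × Fin 3)) * (btRad β)) ^ 2 +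
        stepActionErr (L := L) (btRad β) 0)) * Real.exp (-(β * btMfar L (D * recordDelta1 L (1 / 6) β) (A * powScale (1 / 2) β * Real.sqrt (btLog β)) (btRad β) (btEps β) (13 * (D * recordDelta1 L (1 / 6) β)))) ≤
        (powScale 1 β) / 12 * (gaugeMeasure L).real (gaugeCore L (btEps β / 3)) * (Real.exp (-3) * ((L : ℝ) ^ 3 * β) ^ (-(9 : ℝ) / 2) / 2000)) ∧
      (10 * Real.exp (-((L : ℝ) ^ 3 * β * (A * powScale (1 / 2) β * Real.sqrt (btLog β)) ^ 2)) ≤ (powScale 1 β) / 12 * (Real.exp (-3) * ((L : ℝ) ^ 3 * β) ^ (-(9 : ℝ) / 2) / 2000)) := by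
  have hL1 : (1 : ℝ) ≤ L := by exact_mod_cast NeZero.one_le
  have hL0 : (0 : ℝ) < L := by linarith
  have hL3 : (1 : ℝ) ≤ (L : ℝ) ^ 3 := one_le_pow₀ hL1
  have hN0 : (0 : ℝ) < (Fintype.card (Site 3 L) : ℝ) := by exact_mod_cast Fintype.card_pos
  have hA0 : 0 ≤ A := by linarith
  -- constants
  obtain ⟨K, hKdef⟩ : ∃ K : ℝ, K = 14 * Fintype.card (Edge 3 L) + 100 * Fintype.card (Plaquette 3 L × Fin 3) + 1 := ⟨_, rfl⟩
  obtain ⟨C₁, hC₁, hrhs⟩ := budget_rhs_ge (L := L)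
  obtain ⟨C₃, hC₃def⟩ : ∃ C₃ : ℝ, C₃ = Real.exp (-3) * ((L : ℝ) ^ 3) ^ (-(9 : ℝ) / 2) / 6000 := ⟨_, rfl⟩
  have hC₃ : 0 < C₃ := by
    have : 0 < ((L : ℝ) ^ 3) ^ (-(9 : ℝ) / 2) := Real.rpow_pos_of_pos (by positivity) _
    rw [hC₃def]; positivity
  obtain ⟨p, hpdef⟩ : ∃ p : ℝ, p = (Fintype.card (Site 3 L) : ℝ) * A ^ 2 / 48 := ⟨_, rfl⟩
  have hp : ((3 * Fintype.card (Site 3 L) + 6 : ℕ) : ℝ) < p := by rw [hpdef]; push_cast; linarith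
  obtain ⟨q₁, hq₁def⟩ : ∃ q₁ : ℝ, q₁ = 7056 * D ^ 2 / (Fintype.card (Site 3 L) : ℝ) ^ 2 := ⟨_, rfl⟩
  have hq₁ : 0 < q₁ := by rw [hq₁def]; positivity
  have hNA6 : ((6 : ℕ) : ℝ) < (L : ℝ) ^ 3 * A ^ 2 := by
    rw [← card_site_cube (L := L)]; push_cast; nlinarith [hN0]
  filter_upwards [eventually_budget_elementary (L := L), eventually_btM0_le (L := L), eventually_rate_schedule_facts (L := L) hD,
    eventually_btMnt_ge_rate (L := L) hD (eventually_alphaR_le_btAlpha A), eventually_beta_step_le_one_D (L := L) hD,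
    eventually_exp_neg_btMfar_le_rate (L := L) hD hA,
    eventually_exp_lin_logsq_le (K := K + 1) (p := 3 * ((L : ℝ) ^ 3 * A ^ 2)) one_pos (show 0 < C₁ / 4 by positivity) (3 * Fintype.card (Site 3 L) + 6),
    eventually_exp_lin_logsq_le (K := K + 1) (p := 0) one_pos (show 0 < C₁ * C₃ / 16 by positivity) (3 * Fintype.card (Site 3 L) + 12),
    eventually_exp_lin_logsq_le (K := K) (p := 0) hq₁ (show 0 < C₁ / 8 by positivity) (3 * Fintype.card (Site 3 L) + 6),
    eventually_exp_sub_mul_log_le (K := K) (3 * Fintype.card (Site 3 L) + 6) hp (show 0 < C₁ / 8 by positivity),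
    eventually_exp_sub_mul_log_le (K := Real.log 10) 6 hNA6 (show 0 < C₃ / 4 by positivity),
    eventually_ge_atTop (1 : ℝ)] with β hel hM hf hnt hstep hfar g1 g1' g2a g2b g3 hβ1
  obtain ⟨hB1, hB2, hρR⟩ := hel
  obtain ⟨-, hℓeq, -, hreq, -, -, -, -, -, -, -⟩ := hf
  have hβ0 : 0 < β := by linarith
  have hrhsβ := hrhs β hβ1
  have hrhs' := budget_rhs_ge' (L := L) hβ1
  rw [← hC₃def] at hrhs'
  simp only [zero_mul, add_zero] at g1' g2a
  rw [← hq₁def, ← hpdef] at hfar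
  -- names
  obtain ⟨y, hy⟩ : ∃ y : ℝ, y = powScale 1 β := ⟨_, rfl⟩
  obtain ⟨lB, hlB⟩ : ∃ lB : ℝ, lB = Real.exp (-3) * ((L : ℝ) ^ 3 * β) ^ (-(9 : ℝ) / 2) / 2000 := ⟨_, rfl⟩
  obtain ⟨G, hGdef⟩ : ∃ G : ℝ, G = (gaugeMeasure L).real (gaugeCore L (btEps β / 3)) := ⟨_, rfl⟩
  rw [← hy] at g1 g1' g2a g2b g3 hrhsβ hrhs' ⊢
  rw [← hlB] at hrhsβ hrhs' ⊢
  rw [← hGdef] at hrhsβ ⊢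
  rw [hreq] at hM hnt hfar ⊢
  rw [← hKdef] at hM
  have hy0 : 0 < y := by rw [hy]; exact powScale_pos _ _
  have hy1 : y ≤ 1 := by rw [hy]; exact powScale_le_one zero_le_one β
  have hG0 : 0 ≤ G := by rw [hGdef]; exact measureReal_nonneg
  have hlB0 : 0 < lB := by rw [hlB]; positivity
  have hlB1 : lB ≤ 1 / 2000 := by
    rw [hlB]
    have h1 : Real.exp (-3) ≤ 1 := Real.exp_le_one_iff.mpr (by norm_num)
    have h2 : ((L : ℝ) ^ 3 * β) ^ (-(9 : ℝ) / 2) ≤ 1 := Real.rpow_le_one_of_one_le_of_nonpos hB1 (by norm_num)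
    have h3 : 0 ≤ ((L : ℝ) ^ 3 * β) ^ (-(9 : ℝ) / 2) := Real.rpow_nonneg (by positivity) _
    have := mul_le_mul h1 h2 h3 zero_le_one
    linarith
  -- the threshold identities `3Bα_r² = 3L³A²·log β`, `Bα_r² = L³A²·log β`
  have hℓ0 : 0 ≤ btLog β := le_trans zero_le_one (one_le_btLog β)
  have hβx : β * powScale (1 / 2) β ^ 2 = 1 := mul_powScale_half_sq hβ1
  have hαsq : (A * powScale (1 / 2) β * Real.sqrt (btLog β)) ^ 2 = A ^ 2 * powScale (1 / 2) β ^ 2 * btLog β := by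
    rw [mul_pow, mul_pow, Real.sq_sqrt hℓ0]
  have e1 : (L : ℝ) ^ 3 * β * (A * powScale (1 / 2) β * Real.sqrt (btLog β)) ^ 2 = (L : ℝ) ^ 3 * A ^ 2 * Real.log β := by
    rw [hαsq, ← hℓeq]
    calc (L : ℝ) ^ 3 * β * (A ^ 2 * powScale (1 / 2) β ^ 2 * btLog β) = (L : ℝ) ^ 3 * A ^ 2 * btLog β * (β * powScale (1 / 2) β ^ 2) := by ring
      _ = _ := by rw [hβx, mul_one]
  have e3 : 3 * ((L : ℝ) ^ 3 * β) * (A * powScale (1 / 2) β * Real.sqrt (btLog β)) ^ 2 = 3 * ((L : ℝ) ^ 3 * A ^ 2) * Real.log β := by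
    calc 3 * ((L : ℝ) ^ 3 * β) * (A * powScale (1 / 2) β * Real.sqrt (btLog β)) ^ 2 = 3 * ((L : ℝ) ^ 3 * β * (A * powScale (1 / 2) β * Real.sqrt (btLog β)) ^ 2) := by ring
      _ = _ := by rw [e1]; ring
  -- the exponential pieces
  have aM : Real.exp (β * ((Fintype.card (Edge 3 L) : ℝ) * (2 * (btEps β / 3) + 2 * Real.sqrt 2 * powScale (1 / 2) β) ^ 2) +
      β * ((10 * Real.sqrt (Fintype.card (Plaquette 3 L × Fin 3)) * powScale (1 / 2) β) ^ 2 + stepActionErr (L := L) (powScale (1 / 2) β) 0)) ≤ Real.exp K :=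
    Real.exp_le_exp.mpr hM
  have aE₁ : Real.exp (-(β * btMnt L (D * recordDelta1 L (1 / 6) β) (A * powScale (1 / 2) β * Real.sqrt (btLog β)) (powScale (1 / 2) β) (btR1 β) (btEps β)) +
      β * stepActionErr (L := L) (powScale (1 / 2) β) ((L : ℝ) ^ 3 * (12 * (D * recordDelta1 L (1 / 6) β) ^ 4))) ≤ Real.exp (1 - Real.log β ^ 2) :=
    Real.exp_le_exp.mpr (by linarith)
  have aE₃ : Real.exp (3 * ((L : ℝ) ^ 3 * β) * (A * powScale (1 / 2) β * Real.sqrt (btLog β)) ^ 2) = Real.exp (3 * ((L : ℝ) ^ 3 * A ^ 2) * Real.log β) := by rw [e3]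
  have hK0 : 0 < Real.exp K := Real.exp_pos _
  refine ⟨hB1, hB2, hρR, ?_, ?_, ?_, ?_, ?_⟩
  · -- `(y/12)·lB ≤ 1`
    nlinarith
  · -- (H1)
    rw [aE₃]
    calc _ ≤ Real.exp K * (Real.exp (3 * ((L : ℝ) ^ 3 * A ^ 2) * Real.log β) * Real.exp (1 - Real.log β ^ 2)) :=
          mul_le_mul aM (mul_le_mul_of_nonneg_left aE₁ (Real.exp_pos _).le) (by positivity) hK0.le
      _ = Real.exp (K + 1 + 3 * ((L : ℝ) ^ 3 * A ^ 2) * Real.log β - 1 * Real.log β ^ 2) := by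
          rw [← Real.exp_add, ← Real.exp_add]; congr 1; ring
      _ ≤ C₁ / 4 * y ^ (3 * Fintype.card (Site 3 L) + 6) := g1
      _ ≤ y / 12 * G * lB := by linarith [hrhsβ]
  · -- (H1')
    have hprod : C₁ * y ^ (3 * Fintype.card (Site 3 L) + 6) * (C₃ * y ^ 6) ≤ (y / 3 * G * lB) * (y / 3 * lB) :=
      mul_le_mul hrhsβ hrhs' (by positivity) (by positivity)
    calc _ ≤ Real.exp K * Real.exp (1 - Real.log β ^ 2) := mul_le_mul aM aE₁ (Real.exp_pos _).le hK0.le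
      _ = Real.exp (K + 1 - 1 * Real.log β ^ 2) := by rw [← Real.exp_add]; congr 1; ring
      _ ≤ C₁ * C₃ / 16 * y ^ (3 * Fintype.card (Site 3 L) + 12) := g1'
      _ = C₁ * y ^ (3 * Fintype.card (Site 3 L) + 6) * (C₃ * y ^ 6) / 16 := by ring
      _ ≤ (y / 3 * G * lB) * (y / 3 * lB) / 16 := by linarith [hprod]
      _ = G * (y / 12 * lB) ^ 2 := by ring
  · -- (H2)
    calc _ ≤ Real.exp K * (Real.exp (-(q₁ * Real.log β ^ 2)) + Real.exp (-(p * Real.log β))) := mul_le_mul aM hfar (Real.exp_pos _).le hK0.le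
      _ = Real.exp (K - q₁ * Real.log β ^ 2) + Real.exp (K - p * Real.log β) := by
          rw [mul_add, ← Real.exp_add, ← Real.exp_add, ← sub_eq_add_neg, ← sub_eq_add_neg]
      _ ≤ C₁ / 8 * y ^ (3 * Fintype.card (Site 3 L) + 6) + C₁ / 8 * y ^ (3 * Fintype.card (Site 3 L) + 6) := add_le_add g2a g2b
      _ ≤ y / 12 * G * lB := by linarith [hrhsβ]
  · -- (H3)
    calc 10 * Real.exp (-((L : ℝ) ^ 3 * β * (A * powScale (1 / 2) β * Real.sqrt (btLog β)) ^ 2))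
        = Real.exp (Real.log 10 - (L : ℝ) ^ 3 * A ^ 2 * Real.log β) := by
          rw [e1, ← Real.exp_log (by norm_num : (0 : ℝ) < 10), ← Real.exp_add, Real.log_exp, ← sub_eq_add_neg]
      _ ≤ C₃ / 4 * y ^ 6 := g3
      _ ≤ y / 12 * lB := by linarith [hrhs']

end Summit.QuantumFields.YangMills.Theorems.FemtoTransferGap.TwoLattice.ConstTube

end
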